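import Summits.ResolutionOfSingularities.ResolutionOfSingularities.Theorems.EquisingularLiftEquisingularLiftNatNDLocalNDSquarefree
import Mathlib.Algebra.MvPolynomial.Rename
import HarnessLib

/-!
# [OURS · L1 W4.5(b) · EL♮(3)] WEIGHT-FILTRATION CALCULUS FOR INITIAL FORMS (`…NatNDInitialFormCalculus`): «all monomials weigh `≥ d`» is a
# sub-(semi)ring filtration, the initial form of `g₀ + (heavier)` is `g₀`, a square factor with two monomials kills local Newton
# nondegeneracy, and local Newton nondegeneracy is invariant under renaming the variables

Cell `res-hironaka`, crux EL♮(3) `EquisingularLiftNatThree` (stmt-ResolutionOfSingularities-20148), chain W4.5b, line `sections`.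
res-L1-w45b-iso-w1 g2 (WIDTH seat, D-0157 DOOR 1; self-named brick «S10 is non-ND in every polynomial frame», part 1 of 2).  OURS; NOT a
statement of any manuscript; nothing of [Hironaka2017] is asserted; AI-written kernel algebra, weaker than expert review.  Def-free, `sorry`-free,
standard axioms.  `--kind proof --supports stmt-ResolutionOfSingularities-20148 --as helper`.  Consumed by part 2 `…NatSpecimenS10AllFrames`
(res-L1-w45b-lead-1's RESIDUE-CUSTOMER-S10 §3 / D3-6 claim (H1) in the kernel).

CONTENTS (namespace `…Cruxes.EquisingularLiftNat.Sections.ND`; `wt`, `initialForm`, `IsLocallyNewtonNondegenerate` are the tree's `…Sections` definitions of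
`…NatResidueHypDefsND`; `initialForm_mul`, `exists_torus_zero`, `coeff_initialForm` are res-L1-w45b-nose-w1's ✓ `…NatNDInitialFormMul`):
* §1 the WEIGHT FILTRATION «`∀ m ∈ supp g, d ≤ wt w m`» (spelled out, no new definition): closed under `+`, `-`, `*` (degrees add), powers, scalars;
  `X i` weighs `w i`; with all `w i ≥ 1` a polynomial without constant term weighs `≥ 1` (`one_le_wt_of_constantCoeff_eq_zero`); and the
  HOMOGENEOUS version «`∀ m ∈ supp g, wt w m = d`» closed under the same operations.
* §2 ★ `initialForm_eq_of_add_wtGe` — if `g = g₀ + r` with `g₀ ≠ 0` `w`-homogeneous of weight `d` and every monomial of `r` of weight `≥ d + 1`,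
  then `in_w g = g₀`.
* §3 ★ `not_isLocallyND_of_initialForm_eq_sq_mul` — over `k = k̄`: if `in_w g = S² · Q` for a POSITIVE weight `w` and `S` has two distinct
  monomials, then `g` is NOT locally Newton-nondegenerate (`S` has a torus zero by `exists_torus_zero`; `S²·Q` and all its partials vanish there).
* §4 RENAMING: `wt_mapDomain`, `initialForm_rename`, ★ `isLocallyNewtonNondegenerate_rename_iff` (a permutation `σ` of the variables; weights
  and torus points are transported by `σ`).

References (mathematics): A. G. Kouchnirenko, *Polyèdres de Newton et nombres de Milnor*, Invent. Math. 32 (1976) 1–31, §1 (initial forms,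
non-degeneracy on compact faces) — folklore-level bookkeeping here.
-/

set_option linter.dupNamespace false

noncomputable section

open MvPolynomial

namespace Summit.ResolutionOfSingularities.ResolutionOfSingularities.Cruxes.EquisingularLiftNat.Sections.ND

open Summit.ResolutionOfSingularities.ResolutionOfSingularities.Cruxes.EquisingularLiftNat.Sections

variable {k : Type} [Field k] {N : ℕ}

/-! ## §1 The weight filtration -/

/-- «Every monomial weighs `≥ d`» ⟺ «every coefficient of weight `< d` vanishes». [OURS] -/
theorem wtGe_iff_coeff_eq_zero (w : Fin N → ℤ) (d : ℤ) (g : MvPolynomial (Fin N) k) :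
    (∀ m ∈ g.support, d ≤ wt w m) ↔ ∀ m, wt w m < d → coeff m g = 0 := by
  constructor
  · intro h m hm
    by_contra hc
    exact absurd (h m (mem_support_iff.mpr hc)) (not_le.mpr hm)
  · intro h m hm
    by_contra hc
    exact (mem_support_iff.mp hm) (h m (not_le.mp hc))

/-- The filtration is monotone in the bound. [OURS] -/
theorem wtGe_mono {w : Fin N → ℤ} {d d' : ℤ} {F : MvPolynomial (Fin N) k} (hd : d' ≤ d)
    (hF : ∀ m ∈ F.support, d ≤ wt w m) : ∀ m ∈ F.support, d' ≤ wt w m :=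
  fun m hm => hd.trans (hF m hm)

/-- `0` weighs `≥ d` for every `d`. [OURS] -/
theorem wtGe_zero (w : Fin N → ℤ) (d : ℤ) : ∀ m ∈ (0 : MvPolynomial (Fin N) k).support, d ≤ wt w m := by
  simp

/-- Sums stay in the filtration. [OURS] -/
theorem wtGe_add {w : Fin N → ℤ} {d : ℤ} {F G : MvPolynomial (Fin N) k} (hF : ∀ m ∈ F.support, d ≤ wt w m)
    (hG : ∀ m ∈ G.support, d ≤ wt w m) : ∀ m ∈ (F + G).support, d ≤ wt w m := by
  classical
  intro m hm
  rcases Finset.mem_union.mp (support_add hm) with h | h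
  exacts [hF m h, hG m h]

/-- Negatives stay in the filtration. [OURS] -/
theorem wtGe_neg {w : Fin N → ℤ} {d : ℤ} {F : MvPolynomial (Fin N) k} (hF : ∀ m ∈ F.support, d ≤ wt w m) :
    ∀ m ∈ (-F).support, d ≤ wt w m := by
  intro m hm
  rw [support_neg] at hm
  exact hF m hm

/-- Differences stay in the filtration. [OURS] -/
theorem wtGe_sub {w : Fin N → ℤ} {d : ℤ} {F G : MvPolynomial (Fin N) k} (hF : ∀ m ∈ F.support, d ≤ wt w m)
    (hG : ∀ m ∈ G.support, d ≤ wt w m) : ∀ m ∈ (F - G).support, d ≤ wt w m := by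
  rw [sub_eq_add_neg]
  exact wtGe_add hF (wtGe_neg hG)

/-- Products: the bounds add. [OURS] -/
theorem wtGe_mul {w : Fin N → ℤ} {d₁ d₂ : ℤ} {F G : MvPolynomial (Fin N) k} (hF : ∀ m ∈ F.support, d₁ ≤ wt w m)
    (hG : ∀ m ∈ G.support, d₂ ≤ wt w m) : ∀ m ∈ (F * G).support, d₁ + d₂ ≤ wt w m := by
  classical
  intro m hm
  obtain ⟨a, ha, b, hb, hab⟩ := Finset.mem_add.mp (support_mul F G hm)
  rw [← hab, wt_add]
  exact add_le_add (hF a ha) (hG b hb)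

/-- Powers: the bound multiplies. [OURS] -/
theorem wtGe_pow {w : Fin N → ℤ} {d : ℤ} {F : MvPolynomial (Fin N) k} (hF : ∀ m ∈ F.support, d ≤ wt w m) (n : ℕ) :
    ∀ m ∈ (F ^ n).support, (n : ℤ) * d ≤ wt w m := by
  classical
  induction n with
  | zero =>
    intro m hm
    rw [pow_zero] at hm
    have h1 : m ∈ ({0} : Finset (Fin N →₀ ℕ)) := support_monomial_subset hm
    rw [Finset.mem_singleton] at h1
    rw [h1, wt_zero]; simp
  | succ n ih =>
    intro m hm
    rw [pow_succ] at hm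
    have := wtGe_mul ih hF m hm
    push_cast
    linarith

/-- A constant weighs `≥ 0`. [OURS] -/
theorem wtGe_C (w : Fin N → ℤ) (c : k) : ∀ m ∈ (C c : MvPolynomial (Fin N) k).support, (0 : ℤ) ≤ wt w m := by
  intro m hm
  have h1 : m ∈ ({0} : Finset (Fin N →₀ ℕ)) := support_monomial_subset hm
  rw [Finset.mem_singleton] at h1
  rw [h1, wt_zero]

/-- Scalar multiples stay in the filtration. [OURS] -/
theorem wtGe_C_mul {w : Fin N → ℤ} {d : ℤ} (c : k) {F : MvPolynomial (Fin N) k} (hF : ∀ m ∈ F.support, d ≤ wt w m) :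
    ∀ m ∈ (C c * F).support, d ≤ wt w m := by
  intro m hm
  have := wtGe_mul (wtGe_C w c) hF m hm
  simpa using this

/-- The variable `X i` weighs `w i`. [OURS] -/
theorem wtGe_X (w : Fin N → ℤ) (i : Fin N) : ∀ m ∈ (X i : MvPolynomial (Fin N) k).support, w i ≤ wt w m := by
  intro m hm
  rw [support_X, Finset.mem_singleton] at hm
  rw [hm]
  simp [wt, Finsupp.single_apply]

/-- A monomial `t^e` weighs `wt w e`. [OURS] -/
theorem wtGe_monomial (w : Fin N → ℤ) (e : Fin N →₀ ℕ) (c : k) :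
    ∀ m ∈ (monomial e c : MvPolynomial (Fin N) k).support, wt w e ≤ wt w m := by
  intro m hm
  have h1 : m ∈ ({e} : Finset (Fin N →₀ ℕ)) := support_monomial_subset hm
  rw [Finset.mem_singleton] at h1
  rw [h1]

/-- With all weights `≥ 1`, the weight of an exponent dominates each of its entries. [OURS] -/
theorem le_wt_of_one_le {w : Fin N → ℤ} (hw : ∀ i, 1 ≤ w i) (m : Fin N →₀ ℕ) (i : Fin N) : (m i : ℤ) ≤ wt w m := by
  unfold wt
  have h1 : (m i : ℤ) ≤ w i * (m i : ℤ) := by nlinarith [hw i, (m i).cast_nonneg (α := ℤ)]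
  refine h1.trans ?_
  rw [← Finset.sum_erase_add _ _ (Finset.mem_univ i)]
  have h2 : 0 ≤ ∑ x ∈ Finset.univ.erase i, w x * (m x : ℤ) :=
    Finset.sum_nonneg fun j _ => by nlinarith [hw j, (m j).cast_nonneg (α := ℤ)]
  linarith

/-- With all weights `≥ 1`, a polynomial WITHOUT CONSTANT TERM weighs `≥ 1`. [OURS] -/
theorem one_le_wt_of_constantCoeff_eq_zero {w : Fin N → ℤ} (hw : ∀ i, 1 ≤ w i) {F : MvPolynomial (Fin N) k}
    (hF : constantCoeff F = 0) : ∀ m ∈ F.support, (1 : ℤ) ≤ wt w m := by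
  intro m hm
  by_cases hm0 : m = 0
  · exfalso
    rw [hm0, mem_support_iff] at hm
    exact hm (by rw [← constantCoeff_eq]; exact hF)
  · obtain ⟨i, hi⟩ : ∃ i, m i ≠ 0 := by
      by_contra hcon
      push Not at hcon
      exact hm0 (Finsupp.ext hcon)
    have h1 : (1 : ℤ) ≤ m i := by exact_mod_cast Nat.one_le_iff_ne_zero.mpr hi
    exact h1.trans (le_wt_of_one_le hw m i)

/-- Finite sums stay in the filtration. [OURS] -/
theorem wtGe_sum {w : Fin N → ℤ} {d : ℤ} {ι : Type} (s : Finset ι) (F : ι → MvPolynomial (Fin N) k)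
    (hF : ∀ i ∈ s, ∀ m ∈ (F i).support, d ≤ wt w m) : ∀ m ∈ (∑ i ∈ s, F i).support, d ≤ wt w m := by
  classical
  induction s using Finset.induction_on with
  | empty => rw [Finset.sum_empty]; exact wtGe_zero w d
  | insert a s ha ih =>
    rw [Finset.sum_insert ha]
    exact wtGe_add (hF a (Finset.mem_insert_self a s)) (ih fun i hi => hF i (Finset.mem_insert_of_mem hi))

/-- Finite products: the bounds add up. [OURS] -/
theorem wtGe_prod {w : Fin N → ℤ} {ι : Type} (s : Finset ι) (F : ι → MvPolynomial (Fin N) k) (d : ι → ℤ)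
    (hF : ∀ i ∈ s, ∀ m ∈ (F i).support, d i ≤ wt w m) : ∀ m ∈ (∏ i ∈ s, F i).support, ∑ i ∈ s, d i ≤ wt w m := by
  classical
  induction s using Finset.induction_on with
  | empty =>
    intro m hm
    rw [Finset.prod_empty] at hm
    rw [Finset.sum_empty]
    have h1 : m ∈ ({0} : Finset (Fin N →₀ ℕ)) := support_monomial_subset hm
    rw [Finset.mem_singleton] at h1
    rw [h1, wt_zero]
  | insert a s ha ih =>
    rw [Finset.prod_insert ha, Finset.sum_insert ha]
    exact wtGe_mul (hF a (Finset.mem_insert_self a s)) (ih fun i hi => hF i (Finset.mem_insert_of_mem hi))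

/-! ### The homogeneous version «every monomial weighs exactly `d`» -/

/-- Homogeneous parts add (same weight). [OURS] -/
theorem wtEq_add {w : Fin N → ℤ} {d : ℤ} {F G : MvPolynomial (Fin N) k} (hF : ∀ m ∈ F.support, wt w m = d)
    (hG : ∀ m ∈ G.support, wt w m = d) : ∀ m ∈ (F + G).support, wt w m = d := by
  classical
  intro m hm
  rcases Finset.mem_union.mp (support_add hm) with h | h
  exacts [hF m h, hG m h]

/-- Homogeneous parts multiply (weights add). [OURS] -/
theorem wtEq_mul {w : Fin N → ℤ} {d₁ d₂ : ℤ} {F G : MvPolynomial (Fin N) k} (hF : ∀ m ∈ F.support, wt w m = d₁)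
    (hG : ∀ m ∈ G.support, wt w m = d₂) : ∀ m ∈ (F * G).support, wt w m = d₁ + d₂ := by
  classical
  intro m hm
  obtain ⟨a, ha, b, hb, hab⟩ := Finset.mem_add.mp (support_mul F G hm)
  rw [← hab, wt_add, hF a ha, hG b hb]

/-- Powers of homogeneous polynomials. [OURS] -/
theorem wtEq_pow {w : Fin N → ℤ} {d : ℤ} {F : MvPolynomial (Fin N) k} (hF : ∀ m ∈ F.support, wt w m = d) (n : ℕ) :
    ∀ m ∈ (F ^ n).support, wt w m = (n : ℤ) * d := by
  classical
  induction n with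
  | zero =>
    intro m hm
    rw [pow_zero] at hm
    have h1 : m ∈ ({0} : Finset (Fin N →₀ ℕ)) := support_monomial_subset hm
    rw [Finset.mem_singleton] at h1
    rw [h1, wt_zero]; simp
  | succ n ih =>
    intro m hm
    rw [pow_succ] at hm
    rw [wtEq_mul ih hF m hm]
    push_cast
    ring

/-- Scalar multiples of homogeneous polynomials. [OURS] -/
theorem wtEq_C_mul {w : Fin N → ℤ} {d : ℤ} (c : k) {F : MvPolynomial (Fin N) k} (hF : ∀ m ∈ F.support, wt w m = d) :
    ∀ m ∈ (C c * F).support, wt w m = d := by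
  classical
  intro m hm
  rw [C_mul'] at hm
  exact hF m (support_smul hm)

/-- `X i` is homogeneous of weight `w i`. [OURS] -/
theorem wtEq_X (w : Fin N → ℤ) (i : Fin N) : ∀ m ∈ (X i : MvPolynomial (Fin N) k).support, wt w m = w i := by
  intro m hm
  rw [support_X, Finset.mem_singleton] at hm
  rw [hm]
  simp [wt, Finsupp.single_apply]

/-- A monomial `c·t^e` is homogeneous of weight `wt w e`. [OURS] -/
theorem wtEq_monomial (w : Fin N → ℤ) (e : Fin N →₀ ℕ) (c : k) :
    ∀ m ∈ (monomial e c : MvPolynomial (Fin N) k).support, wt w m = wt w e := by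
  intro m hm
  have h1 : m ∈ ({e} : Finset (Fin N →₀ ℕ)) := support_monomial_subset hm
  rw [Finset.mem_singleton] at h1
  rw [h1]

/-- Finite sums of homogeneous polynomials of the same weight. [OURS] -/
theorem wtEq_sum {w : Fin N → ℤ} {d : ℤ} {ι : Type} (s : Finset ι) (F : ι → MvPolynomial (Fin N) k)
    (hF : ∀ i ∈ s, ∀ m ∈ (F i).support, wt w m = d) : ∀ m ∈ (∑ i ∈ s, F i).support, wt w m = d := by
  classical
  induction s using Finset.induction_on with
  | empty => simp
  | insert a s ha ih =>
    rw [Finset.sum_insert ha]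
    exact wtEq_add (hF a (Finset.mem_insert_self a s)) (ih fun i hi => hF i (Finset.mem_insert_of_mem hi))

/-! ## §2 The initial form of `g₀ + (heavier terms)` is `g₀` -/

/-- **`initialForm_eq_of_add_wtGe`** — if `g = g₀ + r`, `g₀ ≠ 0` has all its monomials of `w`-weight EXACTLY `d`, and all monomials of `r`
weigh `≥ d + 1`, then `in_w g = g₀`. [OURS · L1 W4.5b] -/
theorem initialForm_eq_of_add_wtGe (w : Fin N → ℤ) {d : ℤ} {g g₀ r : MvPolynomial (Fin N) k} (hg : g = g₀ + r) (hg₀ : g₀ ≠ 0)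
    (hhom : ∀ m ∈ g₀.support, wt w m = d) (hr : ∀ m ∈ r.support, d + 1 ≤ wt w m) : initialForm w g = g₀ := by
  classical
  -- coefficients of `g` at weight `d` are those of `g₀`; `r` has none there
  have hr0 : ∀ m, wt w m = d → coeff m r = 0 := by
    intro m hm
    by_contra hc
    have := hr m (mem_support_iff.mpr hc)
    omega
  have hg₀0 : ∀ m, wt w m ≠ d → coeff m g₀ = 0 := by
    intro m hm
    by_contra hc
    exact hm (hhom m (mem_support_iff.mpr hc))
  obtain ⟨m₀, hm₀⟩ := support_nonempty.mpr hg₀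
  have hm₀d : wt w m₀ = d := hhom m₀ hm₀
  have hgm₀ : coeff m₀ g ≠ 0 := by
    rw [hg, coeff_add, hr0 m₀ hm₀d, add_zero]
    exact mem_support_iff.mp hm₀
  have hgs : g.support.Nonempty := ⟨m₀, mem_support_iff.mpr hgm₀⟩
  -- the minimal weight of `g` is `d`
  have hmin : g.support.inf' hgs (wt w) = d := by
    apply le_antisymm
    · rw [← hm₀d]; exact inf'_le_wt w hgs (mem_support_iff.mpr hgm₀)
    · obtain ⟨e, he, heq⟩ := Finset.exists_mem_eq_inf' hgs (wt w)
      rw [heq]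
      have hce : coeff e g ≠ 0 := mem_support_iff.mp he
      rw [hg, coeff_add] at hce
      by_cases hed : wt w e = d
      · exact hed.symm.le
      · rw [hg₀0 e hed, zero_add] at hce
        have := hr e (mem_support_iff.mpr hce)
        omega
  ext m
  rw [coeff_initialForm w hgs, hmin]
  by_cases hmd : wt w m = d
  · rw [if_pos hmd, hg, coeff_add, hr0 m hmd, add_zero]
  · rw [if_neg hmd, hg₀0 m hmd]

/-! ## §3 A square factor with two monomials in the initial form kills local Newton nondegeneracy -/

/-- **`not_isLocallyND_of_initialForm_eq_sq_mul`** — over an algebraically closed field: if for some POSITIVE weight `w` the initial form is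
`in_w g = S² · Q` and `S` has two distinct exponents in its support, then `g` is NOT locally Newton-nondegenerate: `S` vanishes at a torus point
`x` (`exists_torus_zero`), hence so do `S²·Q` and all its partial derivatives `2·S·∂ᵢS·Q + S²·∂ᵢQ`. [OURS · L1 W4.5b] -/
theorem not_isLocallyND_of_initialForm_eq_sq_mul [IsAlgClosed k] {w : Fin N → ℤ} (hw : ∀ i, 0 < w i)
    {g S Q : MvPolynomial (Fin N) k} (h : initialForm w g = S ^ 2 * Q) {a b : Fin N →₀ ℕ} (ha : a ∈ S.support) (hb : b ∈ S.support)
    (hab : a ≠ b) : ¬ IsLocallyNewtonNondegenerate g := by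
  intro hND
  obtain ⟨x, hx, hxS⟩ := exists_torus_zero ha hb hab
  refine hND w hw x hx ?_ ?_
  · rw [h, map_mul, map_pow, hxS, zero_pow two_ne_zero, zero_mul]
  · intro i
    rw [h, pderiv_mul, pderiv_pow]
    simp only [map_add, map_mul, map_pow, hxS, zero_pow two_ne_zero, zero_mul, add_zero, map_natCast, Nat.add_one_sub_one,
      pow_one, mul_zero]

/-! ## §4 Renaming the variables -/

/-- The weight of a transported exponent. [OURS] -/
theorem wt_mapDomain (w : Fin N → ℤ) (σ : Fin N ≃ Fin N) (d : Fin N →₀ ℕ) :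
    wt w (Finsupp.mapDomain σ d) = wt (w ∘ σ) d := by
  unfold wt
  rw [← Equiv.sum_comp σ (fun i => w i * ((Finsupp.mapDomain σ d) i : ℤ))]
  refine Finset.sum_congr rfl fun i _ => ?_
  rw [Finsupp.mapDomain_apply σ.injective]
  rfl

/-- The support of a renamed polynomial (permutation of the variables). [OURS] -/
theorem support_rename_equiv (σ : Fin N ≃ Fin N) (g : MvPolynomial (Fin N) k) :
    (rename σ g).support = g.support.image (Finsupp.mapDomain σ) := by
  classical
  exact support_rename_of_injective σ.injective

/-- The coefficient of a renamed polynomial (permutation of the variables). [OURS] -/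
theorem coeff_rename_equiv (σ : Fin N ≃ Fin N) (g : MvPolynomial (Fin N) k) (m : Fin N →₀ ℕ) :
    coeff m (rename σ g) = coeff (Finsupp.mapDomain σ.symm m) g := by
  have hm : m = Finsupp.mapDomain σ (Finsupp.mapDomain σ.symm m) := by
    rw [← Finsupp.mapDomain_comp]
    simp
  conv_lhs => rw [hm]
  exact coeff_rename_mapDomain σ σ.injective g _

/-- **Initial forms commute with renaming**: `in_w (rename σ g) = rename σ (in_{w ∘ σ} g)`. [OURS · L1 W4.5b] -/
theorem initialForm_rename (w : Fin N → ℤ) (σ : Fin N ≃ Fin N) (g : MvPolynomial (Fin N) k) :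
    initialForm w (rename σ g) = rename σ (initialForm (w ∘ σ) g) := by
  classical
  by_cases hg0 : g = 0
  · rw [hg0, map_zero, initialForm_zero, initialForm_zero, map_zero]
  have hg : g.support.Nonempty := support_nonempty.mpr hg0
  have hrg0 : rename σ g ≠ 0 := fun h => hg0 (rename_injective σ σ.injective (by rw [h, map_zero]))
  have hrg : (rename σ g).support.Nonempty := support_nonempty.mpr hrg0
  -- the minimal weights agree
  have hmin : (rename σ g).support.inf' hrg (wt w) = g.support.inf' hg (wt (w ∘ σ)) := by
    apply le_antisymm
    · obtain ⟨e, he, heq⟩ := Finset.exists_mem_eq_inf' hg (wt (w ∘ σ))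
      rw [heq, ← wt_mapDomain]
      refine inf'_le_wt w hrg ?_
      rw [support_rename_equiv]
      exact Finset.mem_image_of_mem _ he
    · obtain ⟨e, he, heq⟩ := Finset.exists_mem_eq_inf' hrg (wt w)
      rw [heq]
      rw [support_rename_equiv, Finset.mem_image] at he
      obtain ⟨e', he', rfl⟩ := he
      rw [wt_mapDomain]
      exact inf'_le_wt (w ∘ σ) hg he'
  ext m
  rw [coeff_initialForm w hrg, coeff_rename_equiv, coeff_rename_equiv, coeff_initialForm (w ∘ σ) hg, hmin]
  have hwm : wt (w ∘ σ) (Finsupp.mapDomain σ.symm m) = wt w m := by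
    rw [← wt_mapDomain, ← Finsupp.mapDomain_comp]
    simp
  rw [hwm]

/-- **Local Newton nondegeneracy is invariant under renaming the variables** (a permutation `σ`; the positive weight `w` and the torus
point `x` are transported to `w ∘ σ`, `x ∘ σ`). [OURS · L1 W4.5b] -/
theorem isLocallyNewtonNondegenerate_rename {σ : Fin N ≃ Fin N} {g : MvPolynomial (Fin N) k}
    (hg : IsLocallyNewtonNondegenerate g) : IsLocallyNewtonNondegenerate (rename σ g) := by
  intro w hw x hx h0 hd
  rw [initialForm_rename, eval_rename] at h0
  refine hg (w ∘ σ) (fun i => hw (σ i)) (x ∘ σ) (fun i => hx (σ i)) h0 fun i => ?_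
  have := hd (σ i)
  rwa [initialForm_rename, pderiv_rename σ.injective, eval_rename] at this

/-- Iff form of `isLocallyNewtonNondegenerate_rename`. [OURS · L1 W4.5b] -/
theorem isLocallyNewtonNondegenerate_rename_iff (σ : Fin N ≃ Fin N) (g : MvPolynomial (Fin N) k) :
    IsLocallyNewtonNondegenerate (rename σ g) ↔ IsLocallyNewtonNondegenerate g := by
  refine ⟨fun h => ?_, fun h => isLocallyNewtonNondegenerate_rename h⟩
  have h' := isLocallyNewtonNondegenerate_rename (σ := σ.symm) h
  rwa [rename_rename, show (σ.symm ∘ σ : Fin N → Fin N) = id from funext fun i => σ.symm_apply_apply i, rename_id,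
    AlgHom.id_apply] at h'

end Summit.ResolutionOfSingularities.ResolutionOfSingularities.Cruxes.EquisingularLiftNat.Sections.ND

end
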